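import Literature.NumberTheory.Sieve.LargestPrimeFactorCubicDivisorSet
import HarnessLib

/-!
# Irving 2015, §4 / Lemma 4.1: the refined covering `𝒟 = ⋃_{k=[h/3]}^K 𝒟_k` with `k(n)`

Eighth proved layer under the named fact `Irving2015_largestPrimeFactor_cubic`
(`LargestPrimeFactorCubic.lean`; A. J. Irving, arXiv:1412.0024 = Acta Arith. 171 (2015)), the
combinatorial half of his second estimate for `T(h,δ)` (Lemma 4.2).  For `n` with
`Ω_δ(n³+2) ≥ h` and `X^δ ≤ p₁ ≤ … ≤ p_h` the `h` smallest prime factors `≥ X^δ`, Irving sets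
`k(n) = max{k ≤ K : p₁⋯p_k ≤ 3X}` (`≥ [h/3]`) and covers `T(h,δ)` by the divisors
`d = p₁⋯p_{k(n)} ∈ 𝒟_{k(n)}`, where membership in `𝒟_k` for `k < K` carries the extra constraint
(4.1) coming from the maximality of `k(n)`.  Everything here is elementary and PROVED, with (4.1)
kept in the exact integer form `(3X)^{h-k} < 10X³·d^{h-k-1}` (from `3X < p₁⋯p_{k+1}` and
`p₁⋯p_k·p_{k+1}^{h-k} ≤ n³ + 2 ≤ 10X³`) instead of Irving's `p₁⋯p_k ≫ X^{(h-k-3)/(h-k-1)}`: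

* `Irving2015.prod_take_mul_pow_le_prod`, `Irving2015.prod_take_succ_eq` — sorted-list facts;
* `Irving2015.exists_dvd_of_le_card_largePrimeFactors_findGreatest` — the covering divisor
  `d = p₁⋯p_{k(n)}` (`k(n)` as `Nat.findGreatest`), with `d ≤ 3X`, `Ω(d) = k(n) ∈ [[h/3], K]`,
  prime factors `p ≥ z` with `z^{k-1}p^{h-k+1} ≤ m`, and (4.1) when `k(n) < K`;
* `Irving2015.card_largeOmega_le_sum_sum_divisorSet` —
  `T(h) ≤ ∑_{k=[h/3]}^{K} ∑_{d∈𝒟_k} #{n ∈ (X,2X] : d ∣ n³+2}` with the explicit finite sets `𝒟_k`.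

The analytic evaluation (tilted `k`-fold prime sums, partial summation against `e^{αs}`) is in
`LargestPrimeFactorCubicWeightedMertens.lean` and the files after it.

## References

* A. J. Irving, *The largest prime factor of `X³ + 2`*, arXiv:1412.0024; Acta Arith. 171 (2015)
  67–80, §4, Lemma 4.1 and the displays before it. [`Irving2014LargestPrimeFactorCubic`]
-/

noncomputable section

open Finset

namespace Literature.NumberTheory.Sieve

namespace Irving2015

/-! ## Irving §4: the refined covering with `k(n) = max{k ≤ K : p₁⋯p_k ≤ 3X}` -/

section CoveringK

/-- Companion of `pow_mul_pow_le_prod_of_mem_take`: in a sorted list of integers `≥ 1` of length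
`≥ h`, for `k < h` and `q` the `(k+1)`-st entry, `(∏ take k) · q^{h-k} ≤ ∏ l`.  Irving, §4:
"`p₁⋯p_{k(n)} p_{k(n)+1}^{h-k(n)} ≤ 9X³`". [cite: Irving2014LargestPrimeFactorCubic, §4 (p. 6)] -/
theorem prod_take_mul_pow_le_prod {l : List ℕ} (hl : l.Pairwise (· ≤ ·)) (h1 : ∀ x ∈ l, 1 ≤ x)
    {k h : ℕ} (hkh : k < h) (hh : h ≤ l.length) {q : ℕ} (hq : q ∈ (l.drop k).take 1) :
    (l.take k).prod * q ^ (h - k) ≤ l.prod := by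
  set A := l.take k with hA
  set R := l.drop k with hR
  have hAR : A ++ R = l := List.take_append_drop _ _
  have hl' := hl
  rw [← hAR, List.pairwise_append] at hl'
  have hlenR : R.length = l.length - k := by rw [hR, List.length_drop]
  -- `q` is the head of `R` and `q ≤ r` for all `r ∈ R`
  have hqR : ∀ r ∈ R, q ≤ r := by
    intro r hr
    obtain ⟨q', R', hqR'⟩ : ∃ q' R', R = q' :: R' := by
      cases hRc : R with
      | nil => rw [hRc] at hq; simp at hq
      | cons q' R' => exact ⟨q', R', rfl⟩
    rw [hqR'] at hq hr hl'
    have hqq : q = q' := by simpa using hq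
    subst hqq
    rcases List.mem_cons.1 hr with rfl | hr'
    · exact le_rfl
    · exact List.rel_of_pairwise_cons hl'.2.1 hr'
  have hqRt : q ^ (h - k) ≤ (R.take (h - k)).prod := by
    have hsf := sublistForall₂_of_forall_mem_le (A := List.replicate (h - k) q)
      (S := R.take (h - k))
      (by rw [List.length_replicate, List.length_take, hlenR]; omega)
      (fun a ha b hb => by
        rw [List.eq_of_mem_replicate ha]
        exact hqR b (List.mem_of_mem_take hb))
    have := hsf.prod_le_prod' (fun b hb => h1 b (by
      rw [← hAR]; exact List.mem_append_right _ (List.mem_of_mem_take hb)))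
    simpa using this
  have hRt : (R.take (h - k)).prod ≤ R.prod :=
    (List.take_sublist _ _).prod_le_prod' (fun b hb => h1 b (by
      rw [← hAR]; exact List.mem_append_right _ hb))
  calc A.prod * q ^ (h - k) ≤ A.prod * (R.take (h - k)).prod := Nat.mul_le_mul_left _ hqRt
    _ ≤ A.prod * R.prod := Nat.mul_le_mul_left _ hRt
    _ = l.prod := by rw [← List.prod_append, hAR]

/-- `take (k+1) = take k ++ [l[k]]`: the product of the first `k + 1` entries is the product of
the first `k` times the `(k+1)`-st entry. [folklore] -/
theorem prod_take_succ_eq {l : List ℕ} {k : ℕ} {q : ℕ} (hq : q ∈ (l.drop k).take 1) :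
    (l.take (k + 1)).prod = (l.take k).prod * q := by
  rw [List.take_add, List.prod_append]
  congr 1
  obtain ⟨q', R', hqR'⟩ : ∃ q' R', l.drop k = q' :: R' := by
    cases hRc : l.drop k with
    | nil => rw [hRc] at hq; simp at hq
    | cons q' R' => exact ⟨q', R', rfl⟩
  rw [hqR'] at hq ⊢
  have hqq : q = q' := by simpa using hq
  subst hqq
  simp

/-- **Irving 2015, §4 / Lemma 4.1** (the covering by `𝒟 = ⋃_{k=[h/3]}^K 𝒟_k`): with
`Ω_z(m)` the number of prime factors `≥ z ≥ 1` of `m` counted with multiplicity, `h ≥ 3`,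
`k₀ = [h/3] ≤ K ≤ h − 1`: if `Ω_z(m) ≥ h`, `m ≤ 10X³`, then for some `k ∈ [k₀, K]`, `m` has a
divisor `d ≤ 3X` (indeed `d = p₁⋯p_k`, `k = k(n)` maximal with `p₁⋯p_k ≤ 3X`) with `Ω(d) = k`, all
prime factors `p` with `z ≤ p`, `z^{k-1}p^{h-k+1} ≤ m`, and, if `k < K`, the maximality constraint
`(3X)^{h-k} < m · d^{h-k-1}` (Irving's (4.1): "`p₁⋯p_{k(n)} ≫ X^{(h-k(n)-3)/(h-k(n)-1)}`", here kept
in exact integer form). [cite: Irving2014LargestPrimeFactorCubic, §4, Lemma 4.1] -/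
theorem exists_dvd_of_le_card_largePrimeFactors_findGreatest {m z h K X : ℕ} (hm : m ≠ 0)
    (hz1 : 1 ≤ z) (hh3 : 3 ≤ h) (hK : h / 3 ≤ K) (hKh : K + 1 ≤ h) (hmX : m ≤ 10 * X ^ 3) (hX : 1 ≤ X)
    (hh : h ≤ ((Nat.primeFactorsList m).filter (fun p => z ≤ p)).length) :
    ∃ k ∈ Icc (h / 3) K, ∃ d : ℕ, d ∣ m ∧ 1 ≤ d ∧ d ≤ 3 * X ∧
      ArithmeticFunction.cardFactors d = k ∧
      (∀ p : ℕ, p.Prime → p ∣ d → z ≤ p ∧ z ^ (k - 1) * p ^ (h - k + 1) ≤ m) ∧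
      (k < K → (3 * X) ^ (h - k) < m * d ^ (h - k - 1)) := by
  classical
  set L := (Nat.primeFactorsList m).filter (fun p => z ≤ p) with hL
  set k₀ := h / 3 with hk₀
  have hsubL : L.Sublist (Nat.primeFactorsList m) := List.filter_sublist
  have hprimeL : ∀ p ∈ L, p.Prime := fun p hp => Nat.prime_of_mem_primeFactorsList (hsubL.subset hp)
  have hsorted : L.Pairwise (· ≤ ·) := (Nat.primeFactorsList_sorted m).pairwise.sublist hsubL
  have h1 : ∀ p ∈ L, 1 ≤ p := fun p hp => (hprimeL p hp).one_lt.le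
  have hzL : ∀ p ∈ L, z ≤ p := fun p hp => by simpa using (List.mem_filter.1 hp).2
  have hLm : L.prod ≤ m := by
    calc L.prod ≤ (Nat.primeFactorsList m).prod :=
          hsubL.prod_le_prod' (fun p hp => (Nat.prime_of_mem_primeFactorsList hp).one_lt.le)
      _ = m := Nat.prod_primeFactorsList hm
  -- the predicate and `k(n)`
  set P : ℕ → Prop := fun k => (L.take k).prod ≤ 3 * X with hP
  set kf := Nat.findGreatest P K with hkf
  -- `P k₀` holds: `(∏ take k₀)³ ≤ m ≤ 10X³ < 27X³`
  have hPk₀ : P k₀ := by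
    have h3 := prod_take_pow_three_le_prod hsorted h1 (by omega : 3 * k₀ ≤ L.length)
    have hlt : (L.take k₀).prod ^ 3 < (3 * X) ^ 3 := by
      refine lt_of_le_of_lt (h3.trans (hLm.trans hmX)) ?_
      have hx3 : 1 ≤ X ^ 3 := Nat.one_le_pow _ _ hX
      have e2 : (3 * X) ^ 3 = 27 * X ^ 3 := by ring
      rw [e2]; generalize X ^ 3 = Y at hx3 ⊢; omega
    exact (lt_of_pow_lt_pow_left₀ 3 (by positivity) hlt).le
  have hkf₀ : k₀ ≤ kf := Nat.le_findGreatest hK hPk₀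
  have hkfK : kf ≤ K := Nat.findGreatest_le K
  have hPkf : P kf := Nat.findGreatest_spec hK hPk₀
  have hkf1 : 1 ≤ kf := by omega
  have hkfh : kf ≤ h := by omega
  have hprimek : ∀ p ∈ L.take kf, p.Prime := fun p hp => hprimeL p (List.mem_of_mem_take hp)
  refine ⟨kf, mem_Icc.2 ⟨hkf₀, hkfK⟩, (L.take kf).prod, ?_, ?_, hPkf, ?_, ?_, ?_⟩
  · calc (L.take kf).prod ∣ (Nat.primeFactorsList m).prod :=
          ((List.take_sublist kf L).trans hsubL).prod_dvd_prod
      _ = m := Nat.prod_primeFactorsList hm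
  · exact List.one_le_prod_of_one_le (l := L.take kf) fun p hp => h1 p (List.mem_of_mem_take hp)
  · have hperm := Nat.primeFactorsList_unique (n := (L.take kf).prod) rfl hprimek
    rw [ArithmeticFunction.cardFactors_apply, ← hperm.length_eq, List.length_take]
    omega
  · intro p hp hpd
    obtain ⟨q, hq, hpq⟩ := (Prime.dvd_prod_iff hp.prime).1 hpd
    obtain rfl : p = q := (Nat.prime_dvd_prime_iff_eq hp (hprimek q hq)).1 hpq
    refine ⟨hzL p (List.mem_of_mem_take hq), ?_⟩
    exact (pow_mul_pow_le_prod_of_mem_take hsorted hz1 hzL hkf1 hkfh hh hq).trans hLm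
  · intro hlt
    -- maximality: `¬ P (kf + 1)`
    have hnot : ¬ P (kf + 1) := Nat.findGreatest_is_greatest (Nat.lt_succ_self _) (by omega)
    -- the next prime `q = L[kf]`
    have hlen : kf < L.length := by omega
    obtain ⟨q, hq⟩ : ∃ q, q ∈ (L.drop kf).take 1 := by
      have : 0 < ((L.drop kf).take 1).length := by
        rw [List.length_take, List.length_drop]; omega
      obtain ⟨q, hq⟩ := List.exists_mem_of_length_pos this
      exact ⟨q, hq⟩
    have hsucc := prod_take_succ_eq (l := L) hq
    rw [hP] at hnot
    simp only [not_le] at hnot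
    rw [hsucc] at hnot
    -- `d · q^{h - kf} ≤ m`
    have hdq := (prod_take_mul_pow_le_prod hsorted h1 (by omega : kf < h) hh hq).trans hLm
    -- `(3X)^{h-kf} < (d q)^{h-kf} = d^{h-kf-1} · (d · q^{h-kf}) ≤ d^{h-kf-1} · m`
    have hpos : 0 < h - kf := by omega
    calc (3 * X) ^ (h - kf) < ((L.take kf).prod * q) ^ (h - kf) :=
          Nat.pow_lt_pow_left hnot (by omega)
      _ = (L.take kf).prod ^ (h - kf - 1) * ((L.take kf).prod * q ^ (h - kf)) := by
          rw [mul_pow]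
          conv_lhs => rw [show h - kf = (h - kf - 1) + 1 from by omega]
          rw [pow_succ]
          rw [show (h - kf - 1) + 1 = h - kf from by omega]
          ring
      _ ≤ (L.take kf).prod ^ (h - kf - 1) * m := Nat.mul_le_mul_left _ hdq
      _ = m * (L.take kf).prod ^ (h - kf - 1) := by ring

end CoveringK

/-- **Irving 2015, §4**: `T(h,δ) ≤ ∑_{k=[h/3]}^{K} ∑_{d ∈ 𝒟_k} A_d` with the explicit finite sets
`𝒟_k = {1 ≤ d ≤ 3X : Ω(d) = k, ∀ p ∣ d prime: z ≤ p ∧ z^{k-1}p^{h-k+1} ≤ 10X³,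
k < K ⇒ (3X)^{h-k} < 10X³·d^{h-k-1}}` (the sets of Lemma 4.1, the implied constant of (4.1) made
explicit and exact). [cite: Irving2014LargestPrimeFactorCubic, §4, Lemma 4.1] -/
theorem card_largeOmega_le_sum_sum_divisorSet (X z h K : ℕ) (hz1 : 1 ≤ z) (hh3 : 3 ≤ h)
    (hK : h / 3 ≤ K) (hKh : K + 1 ≤ h) :
    #((Ioc X (2 * X)).filter fun n : ℕ =>
        h ≤ ((Nat.primeFactorsList (n ^ 3 + 2)).filter (fun p => z ≤ p)).length) ≤
      ∑ k ∈ Icc (h / 3) K, ∑ d ∈ (Icc 1 (3 * X)).filter (fun d : ℕ =>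
          ArithmeticFunction.cardFactors d = k ∧
          (∀ p ∈ d.primeFactors, z ≤ p ∧ z ^ (k - 1) * p ^ (h - k + 1) ≤ 10 * X ^ 3) ∧
          (k < K → (3 * X) ^ (h - k) < 10 * X ^ 3 * d ^ (h - k - 1))),
        #((Ioc X (2 * X)).filter fun n : ℕ => d ∣ n ^ 3 + 2) := by
  classical
  set D : ℕ → Finset ℕ := fun k => (Icc 1 (3 * X)).filter (fun d : ℕ =>
    ArithmeticFunction.cardFactors d = k ∧
    (∀ p ∈ d.primeFactors, z ≤ p ∧ z ^ (k - 1) * p ^ (h - k + 1) ≤ 10 * X ^ 3) ∧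
    (k < K → (3 * X) ^ (h - k) < 10 * X ^ 3 * d ^ (h - k - 1))) with hD
  set S := Ioc X (2 * X) with hS
  -- cover by `∃ k, ∃ d ∈ D k, d ∣ n³+2`
  have hcover : S.filter (fun n : ℕ =>
      h ≤ ((Nat.primeFactorsList (n ^ 3 + 2)).filter (fun p => z ≤ p)).length) ⊆
      S.filter (fun n : ℕ => ∃ k ∈ Icc (h / 3) K, ∃ d ∈ D k, d ∣ n ^ 3 + 2) := by
    intro n hn
    rw [mem_filter] at hn ⊢
    refine ⟨hn.1, ?_⟩
    have hnX := mem_Ioc.1 (by rw [hS] at hn; exact hn.1)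
    have hX : 1 ≤ X := by omega
    have hm10 : n ^ 3 + 2 ≤ 10 * X ^ 3 := by
      have h2 := Nat.pow_le_pow_left hnX.2 3
      have hx3 : 1 ≤ X ^ 3 := Nat.one_le_pow _ _ hX
      have e1 : (2 * X) ^ 3 = 8 * X ^ 3 := by ring
      rw [e1] at h2; generalize X ^ 3 = Y at h2 hx3 ⊢; omega
    obtain ⟨k, hk, d, hd, hd1, hd3X, hΩ, hp, hmax⟩ :=
      exists_dvd_of_le_card_largePrimeFactors_findGreatest (m := n ^ 3 + 2) (by positivity) hz1 hh3
        hK hKh hm10 hX hn.2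
    refine ⟨k, hk, d, ?_, hd⟩
    rw [hD, mem_filter, mem_Icc]
    refine ⟨⟨hd1, hd3X⟩, hΩ, fun p hpd => ?_, fun hlt => ?_⟩
    · have hpp := Nat.prime_of_mem_primeFactors hpd
      obtain ⟨hzp, hbound⟩ := hp p hpp (Nat.dvd_of_mem_primeFactors hpd)
      exact ⟨hzp, hbound.trans hm10⟩
    · exact (hmax hlt).trans_le (Nat.mul_le_mul_right _ hm10)
  calc #(S.filter fun n : ℕ =>
        h ≤ ((Nat.primeFactorsList (n ^ 3 + 2)).filter (fun p => z ≤ p)).length)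
      ≤ #(S.filter fun n : ℕ => ∃ k ∈ Icc (h / 3) K, ∃ d ∈ D k, d ∣ n ^ 3 + 2) := card_le_card hcover
    _ ≤ ∑ k ∈ Icc (h / 3) K, #(S.filter fun n : ℕ => ∃ d ∈ D k, d ∣ n ^ 3 + 2) :=
        card_filter_exists_le_sum S _ (fun k n => ∃ d ∈ D k, d ∣ n ^ 3 + 2)
    _ ≤ ∑ k ∈ Icc (h / 3) K, ∑ d ∈ D k, #(S.filter fun n : ℕ => d ∣ n ^ 3 + 2) :=
        sum_le_sum (fun k _ => card_filter_exists_le_sum S (D k) (fun d n => d ∣ n ^ 3 + 2))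

end Irving2015

end Literature.NumberTheory.Sieve
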